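import Summits.KontsevichZagierPeriods.KontsevichZagierPeriods.Theorems.LogPrimitiveNL.Negative.DimZero
import Literature.NumberTheory.Transcendental.KZProduct

/-!
# `HurwitzSectorComplement` (stmt-KontsevichZagierPeriods-14341) — negative side, III: dimension-`0`
# normal forms never suffice (values of `IntegralRep 0` are real algebraic numbers)

Refuter (`cdisprove`, cycle 1) by-product (landed copy of §5c of the crux work file
`Cruxes/HurwitzSectorComplement/Disproof.lean`): the bounded-dimension strengthening of
`NormalFormPrinciple` at `d = 0` is false.

* `isAlgebraic_value_dimZero` — the value of a dimension-`0` integral representation is a real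
  algebraic number: the value is `0` (empty domain) or `f (pt)`, and a `ℚ`-semialgebraic function over
  the point takes an algebraic value — tree lemma
  `LiouvilleUnfolding.LogPrimitiveNL.Negative.isAlgebraic_of_isSemialgebraicFunOn_fin_zero`, itself from
  `GammaHodgeSectorNegative.isAlgebraic_of_isSemialgebraic_singleton` (a `ℚ`-semialgebraic point of `ℝ¹`
  is algebraic). REUSED, not re-proved (the work file's self-contained tameness proof is not landed).
* `not_reduction_dimZero` — no normal-form family concentrated in dimension `0` is a reduction target:
  `[disc, 1]` (tree `KZ.piRep`) is rational with the transcendental value `π` (tree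
  `transcendental_pi_holds`), and soundness transports values. For `d ≥ 1` the bounded-dimension
  question is open (dimension-`1` values contain the 1-periods of curves).

Sources: M. Kontsevich, D. Zagier, *Periods* (2001), §1.1 (the Definition; constants); J. Bochnak,
M. Coste, M.-F. Roy, *Real Algebraic Geometry* (1998), Prop. 2.1.8; F. Lindemann (1882) via A. Baker,
*Transcendental Number Theory* (1975), Ch. 1 Thm 1.3.
-/

noncomputable section

namespace Summit.KontsevichZagierPeriods.Theorems.HurwitzSectorComplement.Negative

open Set MeasureTheory
open Literature.NumberTheory.Transcendental
open Literature.NumberTheory.Transcendental.KZ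
open Summit.KontsevichZagierPeriods.LiouvilleUnfolding.LogPrimitiveNL.Negative
  (isAlgebraic_of_isSemialgebraicFunOn_fin_zero)

/-- **Values of dimension-`0` integral representations are real algebraic numbers** (the constants of
the calculus lie in `ℚ̄ ∩ ℝ`; conversely every real algebraic number is one, `KZPeriodsProofs`).
[cite: KontsevichZagier2001, §1.1] -/
theorem isAlgebraic_value_dimZero (r : IntegralRep 0) : IsAlgebraic ℚ r.value := by
  rcases Set.eq_empty_or_nonempty r.domain with hd | hd
  · have : r.value = 0 := by rw [IntegralRep.value, hd]; simp
    rw [this]; exact isAlgebraic_zero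
  have hdu : r.domain = univ := by
    obtain ⟨x, hx⟩ := hd
    exact eq_univ_of_forall fun y => by rwa [Subsingleton.elim y x]
  have hval : r.value = r.integrand default := by
    rw [IntegralRep.value, hdu, Measure.restrict_univ, MeasureTheory.volume_pi,
      Measure.pi_of_empty (fun _ : Fin 0 => (volume : Measure ℝ)) default, integral_dirac]
  rw [hval]
  exact isAlgebraic_of_isSemialgebraicFunOn_fin_zero r.isSemialgebraicFunOn_integrand
    (by rw [hdu]; exact mem_univ _)

/-- **STRENGTHENING (bounded dimension, `d = 0`) refuted**: no normal-form family concentrated in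
dimension `0` is a reduction target — `[disc, 1]` has the transcendental value `π` (Lindemann), while
dimension-`0` values are algebraic and soundness (`KZ.Equivalent.value_eq_holds`) transports values.
[cite: Lindemann1882, via BakerTNT1975 Ch. 1 Theorem 1.3, p. 5] -/
theorem not_reduction_dimZero (𝒩 : Set (IntegralRep 0)) :
    ¬ ∀ (n : ℕ) (r : IntegralRep n), r.IsRational → ∃ N : IntegralRep 0, N ∈ 𝒩 ∧ Equivalent r N := by
  intro h
  obtain ⟨N, -, hN⟩ := h 2 piRep ⟨1, 1, fun _ _ => by simp, fun z _ => by simp⟩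
  have hv : Real.pi = N.value := by rw [← piRep_value]; exact Equivalent.value_eq_holds hN
  exact transcendental_pi_holds (hv ▸ isAlgebraic_value_dimZero N)

/-- The same for families indexed by all dimensions but empty above `0` (the shape of
`NormalFormPrinciple`'s witness). [folklore] -/
theorem not_reduction_of_subsingleton_dims (𝒩 : (n : ℕ) → Set (IntegralRep n))
    (h𝒩 : ∀ n, n ≠ 0 → 𝒩 n = ∅) :
    ¬ ∀ (n : ℕ) (r : IntegralRep n), r.IsRational →
      ∃ (m : ℕ) (N : IntegralRep m), N ∈ 𝒩 m ∧ Equivalent r N := by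
  intro h
  refine not_reduction_dimZero (𝒩 0) fun n r hr => ?_
  obtain ⟨m, N, hN, hrN⟩ := h n r hr
  by_cases hm : m = 0
  · subst hm
    exact ⟨N, hN, hrN⟩
  · rw [h𝒩 m hm] at hN
    exact absurd hN (Set.notMem_empty _)

end Summit.KontsevichZagierPeriods.Theorems.HurwitzSectorComplement.Negative
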